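import Mathlib

/-!
# STUB-IDEAS k3 (gen 21) — «RUBIN'S ELIMINATION AT 2»: D3 without a 2-adic Waldspurger formula
# and without a main conjecture — the index of the elliptic-unit class CANCELS.

Typed sketch (Mathlib-only) for the stub-ideation card
`Cruxes/SplitBadTwoLowerHalfOfFacts/Ideas/stub_heegnerIndexLowerAtTwo-k3.md` (gen 21, k = 3,
technique = DECOMPOSITION: split into sub-stubs with a provable glue).

Crux `PrintCf2.SplitBadTwoLowerHalfOfFacts` (stmt-BirchSwinnertonDyer-27851), stub of record
`stub_heegnerIndexLowerAtTwo` (skeleton sha16 f2bd84c029a8a938).  STUB-PLAN v4.2: the only research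
node on LOWER's own path is D3 = (a-∃) ρ1′ + R144 (the EXISTENCE of the period × algebraic-value law
for the Katz–Rubin value `val_W` at the 𝔭-ramified out-of-range point, sourced so far from LZZ's
p-adic Waldspurger formula at a 2-ramified anticyclotomic character of the good pair).

THIS ROAD («road R», Rubin 1992's ORIGINAL architecture, BDP-PJM 2012 eqs. (1)–(5)): four laws on
W's OWN frame, all on the 𝔭-face / cyclotomic direction, whose unknown — the coordinate `c` of the
elliptic-unit Selmer class `κ_W` relative to the generator `P` in the rank-one line `Sel₂(W/ℚ) ⊗ ℚ₂` —
CANCELS, as does the 2-adic height `h = ⟨P,P⟩₂`: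

* S1 (ERL-OUT₂ / Leopoldt–Kronecker, de Shalit II.5.2 at p = 2 + limit up the 𝔭*-tower):
      `c · log_ω P = e₁ · Ω_p · val_W`
* S2 (Rubin's 2-adic height formula, Nekovář-type «Rubin formula» for the bottom of a Λ-adic class):
      `c · ⟨P,P⟩₂ · Ω_p = e₂ · 𝓛′_cyc(ν_W) · log_ω P`
* S3 (COLIN, from the bundle: rank 1 ∧ Ш[2^∞] finite ⟹ finrank (Sel ⊗ ℚ₂) = 1): `κ_W = c • P`
* S4 (2-adic Gross–Zagier in Rubin's normalisation = Disegni 2017 Thm B ÷ archimedean GZ, cyclotomic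
      Artin factorisation pinned in range):  `𝓛′_cyc(ν_W) = e₃ · q_W · Ω_p · ⟨y_K,y_K⟩₂`,
      `q_W := L′(W/K,1)/(Ω_{W/K} ĥ(y_K)) ∈ ℚˣ`
* S5 (bilinearity, `y_K = I • P` in `Sel ⊗ ℚ₂`): `⟨y_K,y_K⟩₂ = I² ⟨P,P⟩₂`.

GLUE (PROVED below): `val_W = (e₂e₃/e₁) · q_W · I² · (log_ω P)² / Ω_p` — Rubin's Theorem 1 shape
`Ω_p⁻¹ log²(P) · (rational)` with the rational factor `q_W I² = L′(W/K,1)/(Ω ĥ(P))` = Ш_an-currency.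
Valuation shadow: `m_W = 2 v₂(val_W) = 2(A_W + g_W) + α_R`, `α_R = κ + 2(E₂ + E₃ − E₁ − Ω)` EXPLICIT
and member-free once the three constants are read ⟹ (a-∃) ρ1′ is PRODUCED (not assumed) on this road,
and (a-norm) becomes the `(e₁,e₂,e₃)`-READ; D3 (B28 strict norm form) ⟺ `α_R ≥ −1`.

NO MAIN CONJECTURE, NO DESCENT, NO SHIMURA-CURVE TEST VECTOR, NO REALISATION Φ : A_ξ → W enters the
value law.  BSD is NOT proved by any of this: S1, S2, S4 at p = 2 for the additive member are research
stubs (M / M / S-after-k2-g21's Disegni audit); this file proves only the glue and the bookkeeping.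

rc 0 expected, 0 sorry.  Namespace per the crux-workfile convention.
-/

set_option linter.dupNamespace false

namespace Summit.BirchSwinnertonDyer.BirchSwinnertonDyer.Cruxes.SplitBadTwoLowerHalfOfFacts.RubinEliminationK3G21

/-! ## §A  S3 / S5 — the rank-one line: colinearity and bilinear scaling (Mathlib-provable NOW) -/
section Line

variable {K V : Type*} [Field K] [AddCommGroup V] [Module K V]

/-- **S3 (COLIN).** In a one-dimensional `K`-space every vector is a multiple of a fixed non-zero one:
the elliptic-unit class `κ_W` is `c • P` in `Sel₂(W/ℚ) ⊗ ℚ₂ ≅ W(ℚ) ⊗ ℚ₂` (rank one, `Ш[2^∞]` finite —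
both in `𝔅_split`). No Euler-system argument and no main conjecture is used. -/
theorem exists_eq_smul_of_finrank_eq_one (h : Module.finrank K V = 1) {P : V} (hP : P ≠ 0) (κ : V) :
    ∃ c : K, κ = c • P := by
  obtain ⟨c, hc⟩ := (finrank_eq_one_iff_of_nonzero' P hP).mp h κ
  exact ⟨c, hc.symm⟩

/-- **S5 (bilinear scaling).** `⟨I•P, I•P⟩ = I² ⟨P,P⟩` for any bilinear pairing (the 2-adic height on
`Sel ⊗ ℚ₂`, where torsion dies, with `y_K = I • P`). -/
theorem bilin_smul_smul (B : LinearMap.BilinForm K V) (I : K) (P : V) :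
    B (I • P) (I • P) = I ^ 2 * B P P := by
  simp only [map_smul, LinearMap.smul_apply, smul_eq_mul]
  ring

/-- `log (I • P) = I · log P` for the (linear) formal-group logarithm on the line. -/
theorem log_smul (log : V →ₗ[K] K) (I : K) (P : V) : log (I • P) = I * log P := by
  simp

/-- Height against the elliptic-unit class: with `κ = c • P`, `⟨κ, P⟩ = c ⟨P,P⟩` and
`log κ = c log P` — the two quantities S1 / S2 evaluate. -/
theorem pair_and_log_of_colinear (B : LinearMap.BilinForm K V) (log : V →ₗ[K] K) {κ P : V} {c : K}
    (hκ : κ = c • P) : B κ P = c * B P P ∧ log κ = c * log P := by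
  subst hκ
  simp [map_smul, LinearMap.smul_apply, smul_eq_mul]

end Line

/-! ## §B  The exact elimination: S1 ∧ S2 ∧ S4 ∧ S5 ⟹ Rubin's value law (c and ⟨P,P⟩ cancel) -/
section Elimination

variable {F : Type*} [Field F]

/-- The four laws of road R as identities in a field `F` (= `ℂ₂`, or `ℚ₂(Ω_p)`):
`val` the Katz–Rubin value of the member, `c` the coordinate of the elliptic-unit class, `ℓ = log_ω P`,
`h = ⟨P,P⟩₂`, `hK = ⟨y_K,y_K⟩₂`, `L' = 𝓛′_cyc(ν_W)`, `Ωp` the 2-adic period of the frame,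
`e₁ e₂ e₃` the explicit local constants (Gauss sum / boundary Euler factors / Disegni ÷ GZ constant),
`q` the Gross–Zagier rational `L′(W/K,1)/(Ω_{W/K} ĥ(y_K))`, `I` the Heegner index. -/
structure RubinRoadLaws (val c ℓ h hK L' Ωp e₁ e₂ e₃ q I : F) : Prop where
  /-- S1: ERL-OUT₂ (Leopoldt–Kronecker evaluation of the frame measure at the Rubin point). -/
  S1 : c * ℓ = e₁ * Ωp * val
  /-- S2: Rubin's height formula at `y = P`. -/
  S2 : c * h * Ωp = e₂ * L' * ℓ
  /-- S4: 2-adic Gross–Zagier in Rubin's normalisation. -/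
  S4 : L' = e₃ * q * Ωp * hK
  /-- S5: `y_K = I • P`. -/
  S5 : hK = I ^ 2 * h

/-- **GLUE of road R (the elimination).** The coordinate `c` of the elliptic-unit class and the 2-adic
height `h = ⟨P,P⟩₂ ≠ 0` (Bertrand 1984 §3 Cor. 1, via the good partner over the twist field) CANCEL:
`val = (e₂ e₃ / e₁) · q · I² · ℓ² / Ω_p` — Rubin 1992 Thm 1's shape `Ω_p⁻¹ log²(P) · (explicit rational)`,
obtained with NO main conjecture and NO p-adic Waldspurger formula. -/
theorem val_eq_of_laws {val c ℓ h hK L' Ωp e₁ e₂ e₃ q I : F}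
    (H : RubinRoadLaws val c ℓ h hK L' Ωp e₁ e₂ e₃ q I)
    (hh : h ≠ 0) (hΩ : Ωp ≠ 0) (he₁ : e₁ ≠ 0) :
    val = (e₂ * e₃ / e₁) * q * I ^ 2 * ℓ ^ 2 / Ωp := by
  obtain ⟨S1, S2, S4, S5⟩ := H
  -- S2 ∧ S4 ∧ S5:  c · (h Ω_p) = (e₂ e₃ q I² ℓ) · (h Ω_p)
  have hc : c = e₂ * e₃ * q * I ^ 2 * ℓ := by
    have key : c * (h * Ωp) = (e₂ * e₃ * q * I ^ 2 * ℓ) * (h * Ωp) := by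
      calc c * (h * Ωp) = c * h * Ωp := by ring
        _ = e₂ * L' * ℓ := S2
        _ = (e₂ * e₃ * q * I ^ 2 * ℓ) * (h * Ωp) := by rw [S4, S5]; ring
    exact mul_right_cancel₀ (mul_ne_zero hh hΩ) key
  -- plug into S1
  have key' : e₁ * Ωp * val = e₂ * e₃ * q * I ^ 2 * ℓ ^ 2 := by rw [← S1, hc]; ring
  have hne' : e₁ * Ωp ≠ 0 := mul_ne_zero he₁ hΩ
  have hval : val = e₂ * e₃ * q * I ^ 2 * ℓ ^ 2 / (e₁ * Ωp) := by
    rw [eq_div_iff hne']; linear_combination key'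
  rw [hval]
  field_simp

/-- Degenerate branch: if the elliptic-unit class vanishes in the line (`c = 0`) then `val = 0` by S1 —
and D3 (`‖val‖ < 2^{1−x}`) holds trivially; CONT⁻ (`2^{−n′} ≤ ‖val‖`) excludes this anyway. -/
theorem val_eq_zero_of_c_eq_zero {val c ℓ Ωp e₁ : F} (S1 : c * ℓ = e₁ * Ωp * val) (hc : c = 0)
    (hΩ : Ωp ≠ 0) (he₁ : e₁ ≠ 0) : val = 0 := by
  have h0 : e₁ * Ωp * val = 0 := by rw [← S1, hc, zero_mul]
  simpa [mul_eq_zero, he₁, hΩ] using h0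

/-- Conversely `val ≠ 0` (⟸ CONT⁻) forces `c ≠ 0` and hence, by S2 with `h Ω_p ≠ 0`, `𝓛′_cyc ≠ 0`:
no separate non-vanishing input for the cyclotomic derivative is consumed. -/
theorem deriv_ne_zero_of_val_ne_zero {val c ℓ h L' Ωp e₁ e₂ : F}
    (S1 : c * ℓ = e₁ * Ωp * val) (S2 : c * h * Ωp = e₂ * L' * ℓ)
    (hval : val ≠ 0) (hh : h ≠ 0) (hΩ : Ωp ≠ 0) (he₁ : e₁ ≠ 0) : L' ≠ 0 := by
  have hc : c ≠ 0 := by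
    intro hc; exact hval (val_eq_zero_of_c_eq_zero S1 hc hΩ he₁)
  intro hL
  have : c * h * Ωp = 0 := by rw [S2, hL]; ring
  simp [mul_eq_zero, hc, hh, hΩ] at this

end Elimination

/-! ## §C  Valuation shadow (valuations in `ℝ`: Gauss sums have half-integral `v₂`) -/
section Shadow

/-- The laws after `v₂`: `V = v₂ val`, `C = v₂ c`, `ℓ = v₂ log_ω P`, `H = v₂ ⟨P,P⟩₂`, `HK`,
`D = v₂ 𝓛′`, `Ω = v₂ Ω_p`, `Eᵢ = v₂ eᵢ`, `Q = v₂ q_W`, `Iv = v₂ I`. -/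
structure RubinRoadShadow (V C ℓ H HK D Ω E₁ E₂ E₃ Q Iv : ℝ) : Prop where
  S1 : C + ℓ = E₁ + Ω + V
  S2 : C + H + Ω = E₂ + D + ℓ
  S4 : D = E₃ + Q + Ω + HK
  S5 : HK = 2 * Iv + H

/-- `C` and `H` cancel: the value digit is a function of the explicit constants, `q`, `I`, `ℓ` only. -/
theorem V_eq_of_shadow {V C ℓ H HK D Ω E₁ E₂ E₃ Q Iv : ℝ}
    (h : RubinRoadShadow V C ℓ H HK D Ω E₁ E₂ E₃ Q Iv) :
    V = E₂ + E₃ - E₁ + Q + 2 * Iv + 2 * ℓ - Ω := by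
  obtain ⟨S1, S2, S4, S5⟩ := h
  linarith

/-- **ONE-SIDED CONSUMPTION (B1 / R130 declaration).** LOWER consumes each law only as an UPPER bound on
the norm of an ANALYTIC quantity («divisible enough»): S1 as `‖e₁Ω_p val‖ ≤ ‖c log P‖`, S2 as
`‖e₂ 𝓛′ log P‖ ≥ ‖c ⟨P,P⟩ Ω_p‖` read for `C`, S4 as `‖𝓛′‖ ≤ ‖e₃ q Ω_p h_K‖`, S5 as `≥`. -/
structure RubinRoadShadowOneSided (V C ℓ H HK D Ω E₁ E₂ E₃ Q Iv : ℝ) : Prop where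
  S1 : E₁ + Ω + V ≥ C + ℓ
  S2 : C + H + Ω ≥ E₂ + D + ℓ
  S4 : D ≥ E₃ + Q + Ω + HK
  S5 : HK ≥ 2 * Iv + H

theorem V_ge_of_oneSided {V C ℓ H HK D Ω E₁ E₂ E₃ Q Iv : ℝ}
    (h : RubinRoadShadowOneSided V C ℓ H HK D Ω E₁ E₂ E₃ Q Iv) :
    V ≥ E₂ + E₃ - E₁ + Q + 2 * Iv + 2 * ℓ - Ω := by
  obtain ⟨S1, S2, S4, S5⟩ := h
  linarith

/-- The exact shadow is a one-sided shadow. -/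
theorem oneSided_of_shadow {V C ℓ H HK D Ω E₁ E₂ E₃ Q Iv : ℝ}
    (h : RubinRoadShadow V C ℓ H HK D Ω E₁ E₂ E₃ Q Iv) :
    RubinRoadShadowOneSided V C ℓ H HK D Ω E₁ E₂ E₃ Q Iv := by
  obtain ⟨S1, S2, S4, S5⟩ := h
  exact ⟨by linarith, by linarith, by linarith, by linarith⟩

/-- **Road R's net constant.** `κ` is the currency digit of the landed §0 bridges (archimedean GZ +
BSD₀ of the rank-0 twist + `K → ℚ`: `2Q + 4 Iv = 2A + 2t + κ`, `t = v₂ Tam − 2 v₂ #tors`). -/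
def alphaR (E₁ E₂ E₃ Ω κ : ℝ) : ℝ := κ + 2 * (E₂ + E₃ - E₁ - Ω)

/-- **S2′ SHAPE PRODUCED.** With `g = t + 2ℓ`, `x = A + g`: `m = 2V = 2x + α_R` — the member law of the
TOP in its own currency, with `α_R` EXPLICIT (so (a-∃) ρ1′ holds on road R as soon as `E₁,E₂,E₃,Ω,κ` are
member-free, and (a-norm) is the `(e₁,e₂,e₃)`-READ). -/
theorem m_eq_twox_add_alphaR {V ℓ Ω E₁ E₂ E₃ Q Iv A t κ : ℝ}
    (hV : V = E₂ + E₃ - E₁ + Q + 2 * Iv + 2 * ℓ - Ω)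
    (hcur : 2 * Q + 4 * Iv = 2 * A + 2 * t + κ) :
    2 * V = 2 * (A + (t + 2 * ℓ)) + alphaR E₁ E₂ E₃ Ω κ := by
  unfold alphaR; linarith

/-- One-sided version: `2V ≥ 2x + α_R` from the one-sided laws and a one-sided currency digit. -/
theorem m_ge_twox_add_alphaR {V ℓ Ω E₁ E₂ E₃ Q Iv A t κ : ℝ}
    (hV : V ≥ E₂ + E₃ - E₁ + Q + 2 * Iv + 2 * ℓ - Ω)
    (hcur : 2 * Q + 4 * Iv ≥ 2 * A + 2 * t + κ) :
    2 * V ≥ 2 * (A + (t + 2 * ℓ)) + alphaR E₁ E₂ E₃ Ω κ := by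
  unfold alphaR; linarith

/-- **KEY-FREENESS IS STRUCTURAL.** The Gauss digit `n_v/2` of the conductor-`2^{n_v}` twist `φ_δ`
enters `E₁` (Leopoldt–Kronecker `G(χ⁻¹)`, de Shalit II.5.2) and `E₃` (Disegni's wild factor
`Z_w = 2ⁿτ`) with the same sign and cancels in `α_R`. -/
theorem alphaR_gauss_cancel (n a₁ a₃ E₂ Ω κ : ℝ) :
    alphaR (n / 2 + a₁) E₂ (n / 2 + a₃) Ω κ = alphaR a₁ E₂ a₃ Ω κ := by
  unfold alphaR; ring

/-- **D3 in B28 strict norm form from road R.** `‖val‖ = 2^{−V}`, `x = A + g`: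
`2V ≥ 2x + α_R` and `α_R ≥ −1` ⟹ `‖val‖ < 2^{1−x}`. -/
theorem D3_of_roadR {V x α : ℝ} (hm : 2 * V ≥ 2 * x + α) (hα : -1 ≤ α) :
    (2 : ℝ) ^ (-V) < (2 : ℝ) ^ (1 - x) :=
  Real.rpow_lt_rpow_of_exponent_lt (by norm_num) (by linarith)

/-- … and with CONT⁻ (`2^{−n′} ≤ ‖val‖`, `n′ = B + g` by ALG₀) the sandwich closes: `A ≤ B` for integer
`A, B` (the `½` slack is what the integrality of `A − B` absorbs). -/
theorem lower_of_roadR_and_cont {V g α : ℝ} {A B : ℤ}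
    (hm : 2 * V ≥ 2 * ((A : ℝ) + g) + α) (hα : -1 ≤ α)
    (hcont : V ≤ (B : ℝ) + g) : A ≤ B := by
  have h1 : (A : ℝ) - 1 / 2 ≤ (B : ℝ) := by linarith
  have h2 : (A : ℝ) < (B : ℝ) + 1 := by linarith
  have h3 : A < B + 1 := by exact_mod_cast h2
  omega

/-- ANCHOR CONSISTENCY (cheapest falsifier, shared with k3-g20's GHOST bit): at `W₀ = cm7^{(−1)}`
(`A₀ = 0`, `Tam = 8`, `#tors = 2`, `ℓ₀ = 0`: `x₀ = 0 + (3 − 2) + 0 = 1`) the exact law reads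
`2V₀ = 2 + α_R`; so `α_R ≥ −1 ⟺ V₀ ≥ ½ ⟺ ‖val₀‖ < 1`, and the two-sided prediction `α_R = 0` is
`V₀ = 1` (`‖val₀‖ = ½`). Road R COMPUTES `α_R` from `e₁,e₂,e₃,Ω_p,κ` — a unit `val₀` would refute the
READ, not LOWER. -/
example {V₀ α : ℝ} (hm : 2 * V₀ = 2 * 1 + α) : (-1 ≤ α ↔ 1 / 2 ≤ V₀) := by
  constructor <;> intro h <;> linarith

example {V₀ α : ℝ} (hm : 2 * V₀ = 2 * 1 + α) (hα : α = 0) : V₀ = 1 := by linarith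

end Shadow

/-! ## §D  The quantifier shape of (a-∃) on road R

(a-∃) ρ1′ asks for ONE integer `α` with `m_W = 2x_W + α` for every member `W` of the class and every
frame. On road R, `α_R(W) = κ(W) + 2(E₂(W) + E₃(W) − E₁(W) − Ω(W))` is a CLOSED EXPRESSION in local
constants; existence-and-rigidity reduces to «each constant is a function of the local type at 2 and
the Gauss digits cancel» — a finite statement about five explicit quantities, not a p-adic Waldspurger
formula. The lemma below is the (trivial) logical form of that reduction. -/
section Existence

variable {Member : Type*}

/-- If on every member the exact law holds with a member-indexed constant, and that constant is in
fact member-free, then the TOP's ∃-form of S2′ holds. -/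
theorem exists_alpha_of_memberFree (m x αR : Member → ℝ)
    (hlaw : ∀ W, m W = 2 * x W + αR W) (α₀ : ℝ) (hfree : ∀ W, αR W = α₀) :
    ∃ α : ℝ, ∀ W, m W = 2 * x W + α :=
  ⟨α₀, fun W => by rw [hlaw W, hfree W]⟩

/-- One-sided form sufficient for LOWER on the whole class: a UNIFORM floor `αR W ≥ −1`. -/
theorem forall_D3_of_floor (V x αR : Member → ℝ)
    (hlaw : ∀ W, 2 * V W ≥ 2 * x W + αR W) (hfloor : ∀ W, -1 ≤ αR W) :
    ∀ W, (2 : ℝ) ^ (-V W) < (2 : ℝ) ^ (1 - x W) :=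
  fun W => D3_of_roadR (hlaw W) (hfloor W)

end Existence

end Summit.BirchSwinnertonDyer.BirchSwinnertonDyer.Cruxes.SplitBadTwoLowerHalfOfFacts.RubinEliminationK3G21
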